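import Mathlib
import HarnessLib
import Summits.HodgeConjecture.HodgeConjecture.Theses.EightfoldTwistedSheafSeeds
import Summits.HodgeConjecture.HodgeConjecture.Theorems.EightfoldBlochSeedsBlochSpreadEightFourOfLiftedClassIntegralFibre
import Summits.HodgeConjecture.HodgeConjecture.Theorems.EightfoldBlochSeedsBlochSpreadEightFourLiftedClassOfRelativeSurjective

/-!
# Crux `BlochSpreadEightFour` (stmt-HodgeConjecture-18884), line `bloch-lifts-fulton`: the crux BY NAME from
# Bloch's lifting fact and the pure-topology statement `(LS)` (surjectivity of the restriction of relative
# cohomology to the central fibre of the flat lift)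

HONEST FRAMING: a one-line top-of-cone composition (helper; no stub is closed; nothing here proves
`BlochSpreadEightFour` unconditionally, nor rung H2, HC_AV or HC):
`BlochSpreadEightFour_of_blochLifts_of_liftedSupportedClass` (Bloch + `(LC)`, landed) composed with
`liftedSupportedClass_of_surjective_relMap` (`(LS) ⟹ (LC)`, landed). After this hand the line reads

  `BlochSpreadEightFour ⟸ Bloch1972_semiregularSubschemeLifts ∧ (LS)`,

`(LS)` = for a closed subscheme `𝒲` flat over a smooth base inside a smooth projective family, with
INTEGRAL central fibre `𝒲_{v₀}` of codimension exactly `p`, the restriction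
`H²ᵖ(𝒳(ℂ), (𝒳 ∖ 𝒲)(ℂ); ℂ) → H²ᵖ(𝒳_{v₀}(ℂ), (𝒳_{v₀} ∖ 𝒲_{v₀})(ℂ); ℂ)` is onto — a statement about
the topology of the pair `(𝒳(ℂ), 𝒲(ℂ))` only (no cycle class map, no degree / Wirtinger / resolution /
non-vanishing input, no purity).

References: [Bloch1972Semiregularity] Thm. (7.1), (7.4), Remark (7.5); [Fulton1998] §19.2 Cor. 19.2 (b);
[Hatcher2002] §3.1 pp. 199–200.
-/

-- every declaration of this problem lives in `Summit.HodgeConjecture.HodgeConjecture.…` (summit = sub-problem)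
set_option linter.dupNamespace false

noncomputable section

open CategoryTheory CategoryTheory.Limits AlgebraicGeometry Order
open Literature.AlgebraicGeometry.Motives Literature.AlgebraicGeometry.HodgeTheory
open Literature.AlgebraicTopology.SingularHomology

namespace Summit.HodgeConjecture.HodgeConjecture.Theorems

/-- **The crux from Bloch's lifting fact and `(LS)`.** Conditional on the two displayed hypotheses; the
crux item is NOT closed by this theorem. [cite: Bloch1972Semiregularity, Thm. (7.4) and Remark (7.5)]
[cite: Fulton1998, §19.2 Cor. 19.2 (b)] [cite: Hatcher2002, §3.1 pp. 199–200] -/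
theorem BlochSpreadEightFour_of_blochLifts_of_surjective_relMap (hB : Bloch1972_semiregularSubschemeLifts)
    (hLS : ∀ ⦃n p : ℕ⦄ ⦃𝒳 V : SchemeOver ℂ⦄ (g : 𝒳 ⟶ V), 0 < p → IsSmoothProjectiveFamily g n →
      AlgebraicGeometry.Smooth V.hom →
      ∀ (𝒲 : Scheme) (ι : 𝒲 ⟶ 𝒳.left), IsClosedImmersion ι → Flat (ι ≫ g.left) →
      ∀ (v₀ : ComplexPoints V), AlgebraicGeometry.IsIntegral (pullback ι (fiberι g v₀).left) →
      (∀ z : ↥(pullback ι (fiberι g v₀).left),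
        (p : ℕ∞) ≤ Order.coheight ((pullback.snd ι (fiberι g v₀).left).base z)) →
      (∃ z : ↥(pullback ι (fiberι g v₀).left),
        Order.coheight ((pullback.snd ι (fiberι g v₀).left).base z) = (p : ℕ∞)) →
      Function.Surjective (relSingularCohomology.map ℂ ℂ
        (AlgPoints.mapContinuous (L := ℂ) (fiberι g v₀)) (mapsTo_compl_centralFibre g ι v₀) (2 * p))) :
    Summit.HodgeConjecture.HodgeConjecture.Theses.EightfoldTwistedSheafSeeds.BlochSpreadEightFour :=
  BlochSpreadEightFour_of_blochLifts_of_liftedSupportedClass hB (liftedSupportedClass_of_surjective_relMap hLS)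

end Summit.HodgeConjecture.HodgeConjecture.Theorems

end
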